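import Mathlib.Data.Real.Basic
import Mathlib.Algebra.Order.AbsoluteValue.Basic
import Mathlib.Tactic
import HarnessLib

/-!
# The level-two configuration cell of a two-level leg reading, and its margin of engine / grid robustness

Cell `pub-fluidc` (FLUID COMPUTER; host summit `NavierStokesRegularity`, negation side, machine paradigm), prover
seat p1 (gen 7). HONEST FRAMING: low prior, high value-of-information experiment on Tao's machine paradigm; NOT a
claim that NS blows up. Nothing in this file is about the Navier–Stokes equations: it types the finite DECISION RULE by
which the cell reads a pair of two-level leg readings (LEAD PRE-STATEMENT, HOME/STATUS l.4751; RULING R44 (ii)(b)),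
and proves the one fact that makes the rule usable across engines and grids — a reading that holds the configuration
WITH MARGIN keeps it under every perturbation smaller than the margin.

A two-level leg reading `L` carries `r₂ = r₂(out2i)` at its own level-two peak, the two peak instants `t_pk1,U`,
`t_pk2,U`, and its resolution floor `k = min k_max·η_K through t_pk2,U`. The registered objects:

* `InC rNull L` — the LEVEL-TWO CONFIGURATION `C := [r₂ > r_null ∧ t_pk2,U > t_pk1,U]` (hand-off flag);
* `WithMargin rM tM L` — `r₂ ≥ rM ∧ t_pk2,U − t_pk1,U ≥ tM` (registered `rM = 0.437`, `tM = 0.10` over `r_null = 0.397`);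
* `Readable kF L` — `k ≥ kF` (cell (ζ): a leg below the floor `0.9` is not read);
* `cell rNull A B ∈ {alpha, beta, split}` — (α) both legs in `C` (⇒ the K-P3-3 word), (β) neither (⇒ K-P3-2),
  otherwise SPLIT (⇒ no K-word; 384³ legs of both engines) — `cell_eq_alpha_iff`, `cell_eq_beta_iff`, `cell_comm`.

Results: `inC_of_withMargin`; the ROBUSTNESS LEMMA `inC_of_near` — if `A` holds `C` with margin and `B` differs from
`A` by `|Δr₂| < rM − r_null` and `|Δ(t_pk2,U − t_pk1,U)| < tM`, then `B ∈ C`; hence `cell_eq_alpha_of_near` — a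
second engine (or a finer grid) agreeing with a with-margin leg inside the margin CANNOT split the cell. The numeric
section instantiates the night of 2026-08-24 (design (b) `R3D-128-band34-relay-p12-rho3-T3-ws-1` at ν₀/3, 256³):
p1spec (kit j225845: r₂ 0.67221, t_pk 1.3696 / 2.564, k 1.244) and dns-B (kit j226389: 0.6724, 1.365 / 2.5671, 1.235)
are each with margin and readable, the cell is (α), and the cross-engine differences (2·10⁻⁴ in r₂, 8·10⁻³ in Δt_pk)
sit inside a robustness radius of (0.275, 1.09) — three (r₂) and two (Δt_pk) orders of magnitude of room. The K-words themselves are the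
LEAD's (LANDING #38, l.4829); this file only certifies that the lettered arithmetic is engine-robust.
0 sorry; no named fact introduced.
-/

noncomputable section

namespace Summit.NavierStokesRegularity.FluidComputer.LevelTwoConfiguration

/-- A two-level leg reading: `r₂(out2i)` at the leg's own level-two peak, the level-one and level-two peak instants
`t_pk1,U`, `t_pk2,U`, and the resolution floor `min k_max·η_K` through `t_pk2,U`. -/
structure LegReading where
  /-- `r₂ = U_out2i(t_pk2,U) / (λ · U_out(t_pk1,U))` -/
  r2 : ℝ
  /-- level-one peak instant `t_pk1,U` -/
  tpk1 : ℝ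
  /-- level-two peak instant `t_pk2,U` -/
  tpk2 : ℝ
  /-- `min k_max·η_K` through `t_pk2,U` -/
  kres : ℝ

/-- The hand-off delay `Δt_pk = t_pk2,U − t_pk1,U` of a reading. -/
def LegReading.dt (L : LegReading) : ℝ := L.tpk2 - L.tpk1

/-- The level-two configuration `C := [r₂ > r_null ∧ t_pk2,U > t_pk1,U]` (the hand-off flag of the readers). -/
def InC (rNull : ℝ) (L : LegReading) : Prop := rNull < L.r2 ∧ L.tpk1 < L.tpk2

/-- `C` WITH MARGIN: `r₂ ≥ rM` and `Δt_pk ≥ tM` (registered `rM = 0.437`, `tM = 0.10`). -/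
def WithMargin (rM tM : ℝ) (L : LegReading) : Prop := rM ≤ L.r2 ∧ tM ≤ L.dt

/-- Cell (ζ): a leg is READ only if its resolution floor through `t_pk2,U` is at least `kF` (registered `0.9`;
`1.3` for certification at 384³). -/
def Readable (kF : ℝ) (L : LegReading) : Prop := kF ≤ L.kres

/-- The three cells of the pre-statement over a PAIR of legs: (α) both in `C`, (β) neither, otherwise split. -/
inductive Cell
  /-- (α): both legs hold the configuration — the K-P3-3 reading -/
  | alpha
  /-- (β): neither leg holds it — the K-P3-2 reading -/
  | beta
  /-- (γ): the legs disagree — no K-word, escalate both engines to the next grid -/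
  | split
  deriving DecidableEq

open Classical in
/-- The cell of a pair of leg readings at null level `rNull`. -/
def cell (rNull : ℝ) (A B : LegReading) : Cell :=
  if InC rNull A ∧ InC rNull B then Cell.alpha
  else if ¬InC rNull A ∧ ¬InC rNull B then Cell.beta
  else Cell.split

/-- Margin implies configuration, as soon as the margins clear the null: `r_null < rM`, `0 < tM`. -/
theorem inC_of_withMargin {rNull rM tM : ℝ} (hr : rNull < rM) (ht : 0 < tM) {L : LegReading}
    (h : WithMargin rM tM L) : InC rNull L := by
  obtain ⟨h1, h2⟩ := h
  refine ⟨hr.trans_le h1, ?_⟩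
  have : 0 < L.tpk2 - L.tpk1 := ht.trans_le h2
  linarith

/-- ROBUSTNESS: a reading `B` within `|Δr₂| < rM − r_null` and `|ΔΔt_pk| < tM` of a with-margin reading `A` holds
the configuration. (Second engine at matched N, or the same engine one grid up: any perturbation inside the margin.) -/
theorem inC_of_near {rNull rM tM : ℝ} {A B : LegReading} (hA : WithMargin rM tM A)
    (hr : |A.r2 - B.r2| < rM - rNull) (ht : |A.dt - B.dt| < tM) : InC rNull B := by
  obtain ⟨hA1, hA2⟩ := hA
  rw [abs_sub_lt_iff] at hr ht
  obtain ⟨hr1, -⟩ := hr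
  obtain ⟨ht1, -⟩ := ht
  refine ⟨by linarith, ?_⟩
  have hB : 0 < B.dt := by linarith
  have : B.dt = B.tpk2 - B.tpk1 := rfl
  linarith

/-- The cell is (α) exactly when both legs hold the configuration. -/
theorem cell_eq_alpha_iff {rNull : ℝ} {A B : LegReading} :
    cell rNull A B = Cell.alpha ↔ InC rNull A ∧ InC rNull B := by
  unfold cell
  split_ifs with h1 h2 <;> simp [h1]

/-- The cell is (β) exactly when neither leg holds the configuration. -/
theorem cell_eq_beta_iff {rNull : ℝ} {A B : LegReading} :
    cell rNull A B = Cell.beta ↔ ¬InC rNull A ∧ ¬InC rNull B := by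
  unfold cell
  split_ifs with h1 h2
  · simp only [false_iff, not_and, not_not]
    exact fun h => absurd h1.1 h
  · simp [h2]
  · simp [h2]

/-- The cell is SPLIT exactly when the two legs disagree on the configuration. -/
theorem cell_eq_split_iff {rNull : ℝ} {A B : LegReading} :
    cell rNull A B = Cell.split ↔ (InC rNull A ↔ ¬InC rNull B) := by
  unfold cell
  split_ifs with h1 h2
  · simp only [false_iff]
    exact fun h => (h.mp h1.1) h1.2
  · simp only [false_iff]
    exact fun h => h2.1 (by rw [h]; exact h2.2)
  · simp only [true_iff]
    constructor
    · intro hA hB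
      exact h1 ⟨hA, hB⟩
    · intro hB
      by_contra hA
      exact h2 ⟨hA, hB⟩

/-- The cell does not depend on which engine is called first. -/
theorem cell_comm (rNull : ℝ) (A B : LegReading) : cell rNull A B = cell rNull B A := by
  unfold cell
  split_ifs with h1 h2 h3 h4 h5 <;> first | rfl | (exfalso; tauto)

/-- ENGINE / GRID ROBUSTNESS OF (α): a with-margin leg and any second leg inside its margin read (α). -/
theorem cell_eq_alpha_of_near {rNull rM tM : ℝ} (hrm : rNull < rM) (htm : 0 < tM) {A B : LegReading}
    (hA : WithMargin rM tM A) (hr : |A.r2 - B.r2| < rM - rNull) (ht : |A.dt - B.dt| < tM) :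
    cell rNull A B = Cell.alpha :=
  cell_eq_alpha_iff.mpr ⟨inC_of_withMargin hrm htm hA, inC_of_near hA hr ht⟩

/-- Dually, (β) is robust: if `A` misses `C` on the amplitude side with margin (`r₂ ≤ r_null − m`) then every `B`
within `|Δr₂| < m` misses `C` too, and the pair reads (β). -/
theorem cell_eq_beta_of_near {rNull m : ℝ} {A B : LegReading} (hA : A.r2 ≤ rNull - m)
    (hr : |A.r2 - B.r2| < m) : cell rNull A B = Cell.beta := by
  have hm : 0 ≤ m := (abs_nonneg _).trans hr.le
  rw [abs_sub_lt_iff] at hr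
  obtain ⟨-, hr2⟩ := hr
  refine cell_eq_beta_iff.mpr ⟨fun h => ?_, fun h => ?_⟩
  · have := h.1; linarith
  · have := h.1; linarith

/-! ### The registered constants and the night of 2026-08-24 (design (b) at ν₀/3, 256³, two engines) -/

/-- Registered null level `r_null = 0.397` (single-level null at `3·Re₀`, RULING R44). -/
def rNull0 : ℝ := 0.397
/-- Registered amplitude margin `rM = 0.437`. -/
def rM0 : ℝ := 0.437
/-- Registered delay margin `tM = 0.10`. -/
def tM0 : ℝ := 0.10
/-- Registered reading floor `k_max·η_K ≥ 0.9` through `t_pk2,U` (cell (ζ)). -/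
def kF0 : ℝ := 0.9

/-- p1spec + r3fwd 256³ twin of design (b), kit j225845 (HOME/STATUS l.4800): `r₂(out2i) 0.67221 @ t_pk2,U 2.564`,
`t_pk1,U 1.3696`, `k_max·η_K` through `t_pk2,U` `1.244`. -/
def legP1 : LegReading := ⟨0.67221, 1.3696, 2.564, 1.244⟩

/-- dns-B 0.4.0 256³ engine-of-record leg of design (b), kit j226389 (HOME/STATUS l.4827): `r₂(out2i) 0.6724 @ 2.5671`,
`t_pk1,U 1.365`, `k_max·η_K` through `t_pk2,U` `1.235`. -/
def legDnsB : LegReading := ⟨0.6724, 1.365, 2.5671, 1.235⟩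

/-- The registered margins clear the registered null. -/
theorem margins_clear_null : rNull0 < rM0 ∧ (0 : ℝ) < tM0 := by
  unfold rNull0 rM0 tM0; norm_num

/-- Both legs hold the configuration WITH MARGIN and are readable (cell (ζ) does not apply). -/
theorem legs_withMargin_readable :
    WithMargin rM0 tM0 legP1 ∧ WithMargin rM0 tM0 legDnsB ∧ Readable kF0 legP1 ∧ Readable kF0 legDnsB := by
  unfold WithMargin Readable LegReading.dt legP1 legDnsB rM0 tM0 kF0
  norm_num

/-- The pair reads (α) — the arithmetic under the LEAD's K-P3-3 word (LANDING #38). -/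
theorem cell_legs_eq_alpha : cell rNull0 legP1 legDnsB = Cell.alpha :=
  cell_eq_alpha_iff.mpr
    ⟨inC_of_withMargin margins_clear_null.1 margins_clear_null.2 legs_withMargin_readable.1,
      inC_of_withMargin margins_clear_null.1 margins_clear_null.2 legs_withMargin_readable.2.1⟩

/-- The observed cross-engine differences: `|Δr₂| = 1.9·10⁻⁴ < 2·10⁻⁴` and `|ΔΔt_pk| = 7.7·10⁻³ < 8·10⁻³`. -/
theorem legs_cross_engine_deltas :
    |legP1.r2 - legDnsB.r2| < 2e-4 ∧ |legP1.dt - legDnsB.dt| < 8e-3 := by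
  unfold legP1 legDnsB LegReading.dt
  constructor <;> (rw [abs_sub_lt_iff]; norm_num)

/-- ROBUSTNESS RADIUS of p1's leg: EVERY reading within `|Δr₂| < 0.275` and `|ΔΔt_pk| < 1.09` of it holds the
configuration (its own margins over the null are `0.67221 − 0.397 = 0.27521` and `1.1944 − 0`); the observed
cross-engine deltas of `legs_cross_engine_deltas` are three (r₂) / two (Δt_pk) orders of magnitude inside. -/
theorem inC_of_near_legP1 {B : LegReading} (hr : |legP1.r2 - B.r2| < 0.275) (ht : |legP1.dt - B.dt| < 1.09) :
    InC rNull0 B := by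
  have hA : WithMargin (0.672 : ℝ) 1.09 legP1 := by
    unfold WithMargin legP1 LegReading.dt; norm_num
  have hr' : |legP1.r2 - B.r2| < 0.672 - rNull0 := by unfold rNull0; linarith
  exact inC_of_near hA hr' ht

/-! ### The grid step: a RELATIVE agreement on `r₂` and the configuration (p1 gen 8; registered BEFORE the 384³ data)

The LEAD's reading rule for the 384³ leg of design (b) (HOME/STATUS l.4830 (2); dns-B kit j229414, running — no 384³
row exists when this section is filed): 'level two C retained (r₂(out2i) at own t_pk2,U > 0.397 with hand-off;
≥ 0.437 = with margin) … C lost or |Δr₂| > 10 % at 384³ ⇒ counted at 2N, NOT grid-stable at 3N'. The 10 % is RELATIVE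
to the 256³ row of record (dns-B j226389, `legDnsB`: r₂ 0.6724, Δt_pk 1.2021). Below: the generic transfer of an
amplitude margin through a relative agreement, and the instance — the grid-stability limb `|Δr₂| ≤ 10 %` ALONE puts
the 384³ `r₂` at `≥ 0.605`, above the with-margin level `0.437`, so on the amplitude side 'grid-stable AND C lost' is
an empty cell: losing `C` through `r₂` costs a relative move of more than `40.9 %`. The timing limb (hand-off,
`t_pk2,U > t_pk1,U`) is independent and stays a limb: it fails only if the delay `1.2021` collapses to `≤ 0`.
Arithmetic only; the words (CERT2, 'certified configuration', 'not grid-stable') are the LEAD's on the data. -/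

/-- AMPLITUDE MARGIN THROUGH A RELATIVE AGREEMENT: if `A` clears the level `rM` with relative room `ε`,
`rM ≤ (1 − ε)·r₂(A)`, then every `B` with `|r₂(A) − r₂(B)| ≤ ε·r₂(A)` clears `rM`. -/
theorem le_r2_of_rel {ε rM : ℝ} {A B : LegReading} (hA : rM ≤ (1 - ε) * A.r2) (hr : |A.r2 - B.r2| ≤ ε * A.r2) :
    rM ≤ B.r2 := by
  have := (abs_sub_le_iff.mp hr).1
  linarith

/-- Hence: relative agreement inside the room plus the timing limb give the configuration WITH MARGIN. -/
theorem withMargin_of_rel {ε rM tM : ℝ} {A B : LegReading} (hA : rM ≤ (1 - ε) * A.r2)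
    (hr : |A.r2 - B.r2| ≤ ε * A.r2) (ht : tM ≤ B.dt) : WithMargin rM tM B :=
  ⟨le_r2_of_rel hA hr, ht⟩

/-- Contrapositive on the amplitude side: a `B` found at or below a level `rL` with `rL < (1 − ε)·r₂(A)` differs from
`A` by MORE than `ε·r₂(A)`. -/
theorem rel_lt_of_r2_le {ε rL : ℝ} {A B : LegReading} (hA : rL < (1 - ε) * A.r2) (hB : B.r2 ≤ rL) :
    ε * A.r2 < |A.r2 - B.r2| := by
  have h1 : ε * A.r2 < A.r2 - B.r2 := by linarith
  exact h1.trans_le (le_abs_self _)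

/-- The 256³ row of record leaves relative room `35 %` over the with-margin level and `40.9 %` over the null:
`0.437 ≤ 0.65 · 0.6724` and `0.397 < 0.591 · 0.6724`; in particular the letter's `10 %` is inside both. -/
theorem legDnsB_rel_room :
    rM0 ≤ (1 - 0.35) * legDnsB.r2 ∧ rNull0 < (1 - 0.409) * legDnsB.r2 ∧ rM0 ≤ (1 - 0.10) * legDnsB.r2 := by
  unfold rM0 rNull0 legDnsB; norm_num

/-- GRID-STABLE ⟹ AMPLITUDE SIDE OF `C` WITH MARGIN: any 384³ reading within the letter's `10 %` of the 256³ `r₂`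
has `r₂ ≥ 0.605 > 0.437`; with the hand-off limb (`t_pk2,U > t_pk1,U`) it is in `C`, and with `Δt_pk ≥ 0.10` it is
with margin. -/
theorem dnsB384_of_gridStable {B : LegReading} (hr : |legDnsB.r2 - B.r2| ≤ 0.10 * legDnsB.r2) :
    0.605 ≤ B.r2 ∧ (0 < B.dt → InC rNull0 B) ∧ (tM0 ≤ B.dt → WithMargin rM0 tM0 B) := by
  have h605 : (0.605 : ℝ) ≤ B.r2 := by
    have hA : (0.605 : ℝ) ≤ (1 - 0.10) * legDnsB.r2 := by unfold legDnsB; norm_num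
    exact le_r2_of_rel hA hr
  refine ⟨h605, fun ht => ?_, fun ht => withMargin_of_rel legDnsB_rel_room.2.2 hr ht⟩
  refine ⟨by unfold rNull0; linarith, ?_⟩
  have : B.dt = B.tpk2 - B.tpk1 := rfl
  linarith

/-- `C` LOST ON THE AMPLITUDE SIDE ⟹ NOT GRID-STABLE, by a wide margin: a 384³ reading with `r₂ ≤ r_null` differs
from the 256³ row by more than `40.9 %` of it (so by more than the letter's `10 %` a fortiori). -/
theorem dnsB384_C_lost_not_gridStable {B : LegReading} (hB : B.r2 ≤ rNull0) :
    0.409 * legDnsB.r2 < |legDnsB.r2 - B.r2| ∧ ¬ |legDnsB.r2 - B.r2| ≤ 0.10 * legDnsB.r2 := by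
  have h1 := rel_lt_of_r2_le legDnsB_rel_room.2.1 hB
  refine ⟨h1, fun h => ?_⟩
  have : (0 : ℝ) < legDnsB.r2 := by unfold legDnsB; norm_num
  linarith

/-- The timing limb is the only independent one, and it is far from binding: the 256³ delay is `1.2021`, so a 384³
reading keeps the hand-off flag unless its delay moves by at least `1.2021` (the observed 128³→192³→256³→(256³, p1)
delays were 1.184, 1.187, 1.194 / 1.202 — steps of `≤ 0.01`). -/
theorem dnsB384_handoff_of_near_dt {B : LegReading} (ht : |legDnsB.dt - B.dt| < 1.2021) : 0 < B.dt := by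
  have hA : legDnsB.dt = 1.2021 := by unfold LegReading.dt legDnsB; norm_num
  rw [abs_sub_lt_iff] at ht
  linarith [ht.1]

/-- Resolution limb (cell (ζ) at 3N: floor `1.3` through `t_pk2,U`): IF `η_K` through `t_pk2,U` is grid-flat — as in
every coarse/fine pair the cell has read — the 384³ floor is the 256³ one scaled by `k_max` `127/85`, i.e.
`1.235 · 127/85 = 1.845 ≥ 1.3`. The premise is an observation about earlier pairs, not a theorem; only the
arithmetic is certified. -/
theorem dnsB384_readable_if_flat (k384 : ℝ) (hflat : k384 = legDnsB.kres * (127 / 85)) :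
    Readable 1.3 ⟨legDnsB.r2, legDnsB.tpk1, legDnsB.tpk2, k384⟩ ∧ 1.845 ≤ k384 := by
  subst hflat
  unfold Readable legDnsB
  norm_num

/-! ### Registered before the 384³ data (p1 gen 10, 2026-08-25 ≈07:40Z; dns-B kit j229414 / j232158 still running): the resolution limb tolerates a several-fold enstrophy change between the grids

The resolution number is `k_max·η_K` with `η_K = (ν³/ε)^{1/4}`, `ε = 2νZ` (HOME/pub-fluidc-p1/code/p1ns/r3fwd.py
l.305–308; dns-B prints the same diagnostic), so its FOURTH POWER is `(k_max η_K)⁴ = k_max⁴ ν² / (2Z)`. Between the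
256³ and the 384³ leg of ONE field at ONE instant `ν` is common and `k_max` scales by `127/85`; only the enstrophy `Z`
can differ, and `dnsB384_readable_if_flat` above is the case `Z₃₈₄ = Z₂₅₆`. Below, on fourth powers (no roots; only
the algebra of `k⁴ν²/(2Z)` is used): the registered 384³ floor `1.3` survives EVERY enstrophy ratio `Z₃₈₄/Z₂₅₆ ≤ 4` for
design (b) (256³ floor `legDnsB.kres = 1.235`) and `≤ 6` for u0⁽²⁾ (256³ floor through `t_pk,U` `1.374`, dns-B j229326,
HOME/STATUS l.4862; p1spec twin 1.389) — ratios that would themselves say the 256³ leg was grossly unresolved at that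
instant. Reading (information, not a word): the resolution limb of both 384³ letters is decided in advance unless the
grid pair disagrees by hundreds of percent in `Z`; the LIVE limbs are the `2 %` (u0⁽²⁾, `RelativeAgreement.u02_*`) and
`10 %` (design (b), `dnsB384_*` above) agreement limbs and the interior-peak / not-pre-loaded checks. The instant-wise
statement transfers to the minimum through `t_pk2,U` (resp. `t_pk,U`) when the ratio bound holds at every instant of
the window. -/

/-- Scaling law of the fourth power of the resolution number: replacing `k ↦ c·k` and `Z ↦ Z'` multiplies
`k⁴ν²/(2Z)` by `c⁴ · (Z/Z')`. -/
theorem resolv4_scale {k ν Z Z' c : ℝ} (hZ : Z ≠ 0) (hZ' : Z' ≠ 0) :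
    (c * k) ^ 4 * ν ^ 2 / (2 * Z') = c ^ 4 * (Z / Z') * (k ^ 4 * ν ^ 2 / (2 * Z)) := by
  field_simp

/-- FLOOR TRANSFER ACROSS THE GRIDS: a 256³ floor `a⁴ ≤ k⁴ν²/(2Z)` and an enstrophy ratio `Z' ≤ ρ Z` (`Z', ρ > 0`)
give `(c⁴/ρ)·a⁴ ≤ (ck)⁴ν²/(2Z')` at the finer grid (`c = k'_max/k_max ≥ 0`). -/
theorem resolv4_floor_transfer {k ν Z Z' c a ρ : ℝ} (hZ' : 0 < Z') (hρ : 0 < ρ) (hZρ : Z' ≤ ρ * Z)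
    (hfloor : a ^ 4 ≤ k ^ 4 * ν ^ 2 / (2 * Z)) :
    c ^ 4 / ρ * a ^ 4 ≤ (c * k) ^ 4 * ν ^ 2 / (2 * Z') := by
  have hZ : 0 < Z := by nlinarith
  have h1 : 2 * Z * a ^ 4 ≤ k ^ 4 * ν ^ 2 := by
    have := (le_div_iff₀ (by positivity : (0:ℝ) < 2 * Z)).mp hfloor
    linarith
  have hc4 : 0 ≤ c ^ 4 := by positivity
  rw [div_mul_eq_mul_div, div_le_div_iff₀ hρ (by positivity)]
  -- goal: c⁴ a⁴ (2 Z') ≤ (ck)⁴ ν² ρ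
  have h2 : c ^ 4 * a ^ 4 * (2 * Z') ≤ c ^ 4 * a ^ 4 * (2 * (ρ * Z)) := by
    have ha4 : 0 ≤ a ^ 4 := by positivity
    nlinarith [mul_nonneg hc4 ha4]
  have h3 : c ^ 4 * a ^ 4 * (2 * (ρ * Z)) = ρ * (c ^ 4 * (2 * Z * a ^ 4)) := by ring
  have h4 : ρ * (c ^ 4 * (2 * Z * a ^ 4)) ≤ ρ * (c ^ 4 * (k ^ 4 * ν ^ 2)) :=
    mul_le_mul_of_nonneg_left (mul_le_mul_of_nonneg_left h1 hc4) hρ.le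
  have h5 : ρ * (c ^ 4 * (k ^ 4 * ν ^ 2)) = (c * k) ^ 4 * ν ^ 2 * ρ := by ring
  linarith

/-- From fourth powers back to the number: `b⁴ ≤ x⁴`, `x ≥ 0` ⟹ `b ≤ x`. -/
theorem le_of_pow_four_le {b x : ℝ} (hx : 0 ≤ x) (h : b ^ 4 ≤ x ^ 4) : b ≤ x :=
  le_of_pow_le_pow_left₀ (by norm_num) hx h

/-- u0⁽²⁾ (dns-B 256³ floor `1.374` through `t_pk,U`): `(127/85)⁴/6 · 1.374⁴ ≥ 1.3⁴` — the 384³ floor `1.3` holds for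
every enstrophy ratio `Z₃₈₄/Z₂₅₆ ≤ 6`. -/
theorem u02_384_readable_unless_sixfold : (1.3 : ℝ) ^ 4 ≤ (127 / 85 : ℝ) ^ 4 / 6 * 1.374 ^ 4 := by
  norm_num

/-- Design (b) (dns-B 256³ floor `legDnsB.kres = 1.235` through `t_pk2,U`): `(127/85)⁴/4 · 1.235⁴ ≥ 1.3⁴` — the 384³
floor `1.3` holds for every enstrophy ratio `Z₃₈₄/Z₂₅₆ ≤ 4` (margin `1.5 %` on fourth powers; a ratio `4.06` breaks
it). -/
theorem dnsB384_readable_unless_fourfold : (1.3 : ℝ) ^ 4 ≤ (127 / 85 : ℝ) ^ 4 / 4 * legDnsB.kres ^ 4 := by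
  unfold legDnsB
  norm_num

/-- The two instances as statements about the 384³ resolution number itself: if `x₂₅₆ = k η_K` at 256³ has
`x₂₅₆⁴ = k⁴ν²/(2Z)` with `x₂₅₆ ≥ 1.374` (resp. `≥ 1.235`), and `x₃₈₄ ≥ 0` has `x₃₈₄⁴ = ((127/85)k)⁴ν²/(2Z')` with
`0 < Z' ≤ 6Z` (resp. `≤ 4Z`), then `x₃₈₄ ≥ 1.3` — `Readable 1.3` at that instant. -/
theorem readable_384_of_enstrophy_ratio {k ν Z Z' x x' ρ a : ℝ} (hZ' : 0 < Z') (hρ : 0 < ρ) (hZρ : Z' ≤ ρ * Z)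
    (hxa : a ≤ x) (ha : 0 ≤ a) (hx4 : x ^ 4 = k ^ 4 * ν ^ 2 / (2 * Z))
    (hx' : 0 ≤ x') (hx'4 : x' ^ 4 = ((127 / 85) * k) ^ 4 * ν ^ 2 / (2 * Z'))
    (hinst : (1.3 : ℝ) ^ 4 ≤ (127 / 85 : ℝ) ^ 4 / ρ * a ^ 4) : 1.3 ≤ x' := by
  have hfloor : a ^ 4 ≤ k ^ 4 * ν ^ 2 / (2 * Z) := by
    rw [← hx4]; exact pow_le_pow_left₀ ha hxa 4
  have ht := resolv4_floor_transfer (c := 127 / 85) hZ' hρ hZρ hfloor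
  rw [← hx'4] at ht
  exact le_of_pow_four_le hx' (hinst.trans ht)

/-- u0⁽²⁾ instance of the previous theorem (`a = 1.374`, `ρ = 6`). -/
theorem u02_readable_384 {k ν Z Z' x x' : ℝ} (hZ' : 0 < Z') (hZ6 : Z' ≤ 6 * Z) (hxa : 1.374 ≤ x)
    (hx4 : x ^ 4 = k ^ 4 * ν ^ 2 / (2 * Z)) (hx' : 0 ≤ x')
    (hx'4 : x' ^ 4 = ((127 / 85) * k) ^ 4 * ν ^ 2 / (2 * Z')) : 1.3 ≤ x' :=
  readable_384_of_enstrophy_ratio hZ' (by norm_num) hZ6 hxa (by norm_num) hx4 hx' hx'4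
    u02_384_readable_unless_sixfold

/-- Design (b) instance (`a = legDnsB.kres = 1.235`, `ρ = 4`), concluding `Readable 1.3` for the 384³ reading. -/
theorem dnsB_readable_384 {k ν Z Z' x x' : ℝ} (B : LegReading) (hB : B.kres = x') (hZ' : 0 < Z') (hZ4 : Z' ≤ 4 * Z)
    (hxa : legDnsB.kres ≤ x) (hx4 : x ^ 4 = k ^ 4 * ν ^ 2 / (2 * Z)) (hx' : 0 ≤ x')
    (hx'4 : x' ^ 4 = ((127 / 85) * k) ^ 4 * ν ^ 2 / (2 * Z')) : Readable 1.3 B := by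
  unfold Readable
  rw [hB]
  exact readable_384_of_enstrophy_ratio hZ' (by norm_num) hZ4 hxa (by unfold legDnsB; norm_num) hx4 hx' hx'4
    dnsB384_readable_unless_fourfold

/-! ### POST-DATA (p1 gen 10): the dns-B 384³ leg of design (b) u0_b (kit j238058, deposit `atlas/rung-
next/dns-B/r3p3-q/N384/`, 2026-08-25T16:55Z) read by the registered arithmetic above Numbers only (cells (δ)/(ζ),
CERT2 and every word are the LEAD's): `r₂(out2i) = 0.67626` at its own `t_pk2,U = 2.5500`, `t_pk1,U = 1.3977` (`Δt_pk
= 1.1523`), `min k_max·η_K` through `t_pk2,U` = `1.849`, G(t_pk1,U) 1.58076; relative to the 256³ row of record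
`legDnsB.r2 = 0.6724`: `|Δr₂|/r₂ = 0.574 %` — INSIDE the 10 % premise of `dnsB384_of_gridStable`. -/

/-- dns-B 384³ two-level reading of design (b) (kit j238058): `(r₂(out2i), t_pk1,U, t_pk2,U, min k_max·η_K ≤ t_pk2,U)`. -/
def legDnsB384 : LegReading := ⟨0.67626, 1.3977, 2.5500, 1.849⟩

/-- The actual grid agreement on `r₂(out2i)`: `|r₂(256³) − r₂(384³)| ≤ 0.0058 · r₂(256³)`. -/
theorem legDnsB384_rel : |legDnsB.r2 - legDnsB384.r2| ≤ 0.0058 * legDnsB.r2 := by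
  unfold legDnsB legDnsB384; norm_num [abs_le]

/-- The 10 % premise HOLDS ⇒ (registered `dnsB384_of_gridStable`) `r₂(384³) ≥ 0.605`, `C` and WITH MARGIN given the delay. -/
theorem legDnsB384_gridStable :
    0.605 ≤ legDnsB384.r2 ∧ (0 < legDnsB384.dt → InC rNull0 legDnsB384) ∧ (tM0 ≤ legDnsB384.dt → WithMargin rM0 tM0 legDnsB384) :=
  dnsB384_of_gridStable (legDnsB384_rel.trans (by unfold legDnsB; norm_num))

/-- Read DIRECTLY on the 384³ leg (l.4751 definitions): configuration C HOLDS, WITH MARGIN HOLDS, readable at 0.9 yes, at 1.3 yes. -/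
theorem legDnsB384_cells : InC rNull0 legDnsB384 ∧ WithMargin rM0 tM0 legDnsB384 ∧ Readable kF0 legDnsB384 ∧ Readable 1.3 legDnsB384 := by
  unfold InC WithMargin Readable LegReading.dt rNull0 rM0 tM0 kF0 legDnsB384
  norm_num

end Summit.NavierStokesRegularity.FluidComputer.LevelTwoConfiguration

end
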